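import Literature.NumberTheory.EllipticCurves.AdditiveReductionSemistableModelProofs
import Literature.NumberTheory.GaloisRepresentations.PadicCoeffRingDVRProofs
import HarnessLib

/-!
# The Manin constant is a unit at every additive prime `p ≥ 5` — hence `den(c) ∣ 6^∞`
# (finite-height route through `ℚ_p(p^{1/12})`; proofs only)

Topic `NumberTheory/EllipticCurves` (theorems only; no definition, no named fact). Sequel of
`ManinConstantGoodPrimesProofs` (good `p ≥ 5`) and `ManinConstantMultiplicativePrimesProofs`
(multiplicative `p ≥ 5`), in support of the named fact
`Literature.NumberTheory.EllipticCurves.edixhoven_int_of_neronLattice_eq_smul_periodLattice`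
(Edixhoven 1991, Prop. 2: the Manin constant `c_f` of an optimal curve is an integer). For its data
— a globally minimal `W'/ℚ`, `f ∈ S₂(Γ₀(N))` with `IsNewformOf W' f`, a Néron-type period pair `L'` of
`W'`, `q ∈ ℚ` with `Λ_{L'} = q Λ_f` exactly — we prove

  `padicNorm_le_one_of_neronLattice_eq_smul_periodLattice_of_dvd_of_dvd`:
  `‖q‖_p ≤ 1` for every prime `p ≥ 5` of ADDITIVE reduction (`p ∣ Δ_min(W')`, `p ∣ c₄(W')`),

hence (`…_of_five_le`, with the good and multiplicative theorems) **`‖q‖_p ≤ 1` for EVERY prime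
`p ≥ 5`**, i.e. (`dvd_six_of_dvd_den_of_neronLattice_eq_smul_periodLattice`) every prime factor of
`den q` is `2` or `3`: `q ∈ ℤ[1/6]`. For the strong Weil curve `|q| = c_f`, so this is Edixhoven's
integrality `c_f ∈ ℤ` AWAY FROM `6`, obtained without Néron models or the integral model of `X₀(N)`
(the remaining primes `2, 3` need either of them, or the wild semistable reduction).

## The argument at an additive prime `p ≥ 5`

Steps 1–5 of `ManinConstantGoodPrimesProofs` give the short model `E₀ = toShortNF • W' ⊗ ℚ_p`
(`p`-integral, `y² = x³ + Ax + B`, `A, B ∈ ℤ_p`), the modular parametrisation `z₀ = u z ∈ Xℚ_p⟦X⟧`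
with `z₀ ∈ Frac ℤ_p⟦X⟧`, `[X¹]z₀ = u`, `‖u‖_p = ‖q‖_p`, and `log_{E₀}(z₀) = u ℓ`,
`ℓ = Σ aₙ(W')Xⁿ/n`. At an additive prime the formal group of `E₀` has INFINITE height
(`E₀ mod p` is `y² = x³`, `AdditiveReductionSemistableModelProofs`), and this is turned to profit:

6. (Honda witness for free) `log_{E₀}, exp_{E₀} ∈ ℤ_p⟦X⟧` (`FormalGroupInfiniteHeightProofs`) and
   `ℓ ∈ ℤ_p⟦X⟧` (`aₙ = 0` for `p ∣ n`), so `ψ = exp_{E₀}(ℓ) ∈ Xℤ_p⟦X⟧` has `log_{E₀}(ψ) = ℓ`;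
   with `u = n₁/d`: `[d]_{E₀}(z₀) = [n₁]_{E₀}(ψ) =: w ∈ ℤ_p⟦X⟧` (equal logarithms).
7. (semistable model over `O = 𝒪_{ℚ_p(π)}`, `π¹² = p`; `PadicCoeffRingDVRProofs`: a complete DVR with
   residue field of characteristic `p`) By minimality at `p`, `¬(p⁴ ∣ A ∧ p⁶ ∣ B)`, whence
   (`exists_semistableTwistData`) `k < 12` and an `O`-integral twist
   `V'' : y² = x³ + π^{12i−4k}A₁x + π^{12j−6k}B₁` of `E₀` by `u = πᵏ` whose reduction modulo `π` has
   FINITE height (good or multiplicative reduction: potentially good / potentially multiplicative).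
8. (transport) over `ℚ_p(π)`: `V'' = (πᵏ, 0, 0, 0) • E₀`, `z'' := πᵏ z₀`,
   `[d]_{V''}(z'') = πᵏ [d]_{E₀}(z₀) = πᵏ w ∈ O⟦X⟧` (`formalMul_uScale_smul_subst`), and
   `z'' ∈ Frac O⟦X⟧` (`z'' · dQ = πᵏ n₁ P`).
9. (the local lemma over `O`) `Literature.RingTheory.PowerSeries.exists_map_eq_of_subst_eq_map`
   — stated for any complete local PID — gives `z'' ∈ O⟦X⟧`, so `πᵏ u = [X¹]z'' ∈ O`:
   `‖π‖ᵏ ‖u‖ ≤ 1` with `‖π‖¹² = p⁻¹` and `k < 12`, whence `‖u‖ ≤ 1` since `‖u‖ ∈ p^ℤ`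
   (`Padic.norm_le_one_of_pow_mul_norm_le_one`).

## References

* B. Edixhoven, *On the Manin constants of modular elliptic curves*, in: Arithmetic Algebraic
  Geometry (Texel, 1989), Progr. Math. 89 (1991), 25–39, Prop. 2. [EdixhovenManin1991]
* H. Pasten, *Shimura curves and the abc conjecture*, J. Number Theory (2024), §10.1 (p. 33: the
  known results on `c_f`). [PastenShimura2024]
* T. Honda, *On the theory of commutative formal groups*, J. Math. Soc. Japan 22 (1970), 213–246,
  Thm. 2 (p. 223), §6.2 Thm. 9 (pp. 240–241). [Honda1970]
* J.-P. Serre, J. Tate, *Good reduction of abelian varieties*, Ann. of Math. 88 (1968), §2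
  (semistable reduction over an extension of degree dividing `12` for `p ≥ 5`). [folklore]
* J. H. Silverman, *The Arithmetic of Elliptic Curves*, 2nd ed. (2009), VII.1, VII.5.
  [SilvermanAEC2009]
-/

noncomputable section

open scoped Classical IntermediateField

/-! ### Preliminaries -/

namespace WeierstrassCurve

open PowerSeries Literature.NumberTheory.EllipticCurves Literature.RingTheory.FormalGroups
open IsDedekindDomain NumberField Rat.HeightOneSpectrum

section ScaleMul

variable {A : Type*} [CommRing A] [Algebra ℚ A] [IsAddTorsionFree A] [IsDomain A]
  (V : WeierstrassCurve A) (u : Aˣ)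

/-- **`[n]_{S • V}(u z) = u · [n]_V(z)`** for the pure scaling `S = (u, 0, 0, 0)` (over a
`ℚ`-algebra domain; both sides have `log_{S • V}` equal to `n u · log_V`): the multiplication maps
of `Ê` are transported by `θ_S = uX`. [cite: SilvermanAEC2009, IV.2.3] -/
theorem formalMul_uScale_smul_subst (n : ℕ) :
    (((⟨u, 0, 0, 0⟩ : VariableChange A) • V).formalMul n).subst (C (u : A) * X) =
      C (u : A) * V.formalMul n := by
  set SV := (⟨u, 0, 0, 0⟩ : VariableChange A) • V with hSV
  have hXs : HasSubst (C (u : A) * X : A⟦X⟧) := HasSubst.of_constantCoeff_zero' (by simp)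
  have hns : HasSubst (SV.formalMul n) := SV.hasSubst_formalMul n
  have hVns : HasSubst (V.formalMul n) := V.hasSubst_formalMul n
  have h0L : constantCoeff ((SV.formalMul n).subst (C (u : A) * X)) = 0 := by
    rw [Literature.NumberTheory.EllipticCurves.constantCoeff_subst_of_constantCoeff_eq_zero (by simp)]
    exact SV.constantCoeff_formalMul n
  have h0R : constantCoeff (C (u : A) * V.formalMul n) = 0 := by
    rw [map_mul, V.constantCoeff_formalMul, mul_zero]
  refine SV.eq_of_formalLog_subst_eq h0L h0R ?_
  rw [← subst_comp_subst_apply hns hXs, SV.formalLog_subst_formalMul_rat n, ← coe_substAlgHom hXs,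
    map_nsmul, coe_substAlgHom, hSV, V.formalLog_uScale_smul_subst u constantCoeff_X,
    V.formalLog_subst_X, V.formalLog_uScale_smul_subst u (V.constantCoeff_formalMul n),
    V.formalLog_subst_formalMul_rat n, nsmul_eq_mul, nsmul_eq_mul]
  ring

end ScaleMul

section FieldHeight

variable {p : ℕ} [hp : Fact p.Prime] {k : Type*} [Field k] [CharP k p] (E : WeierstrassCurve k)

/-- **`[n]˜ ≠ 0` for every `n ≥ 1` as soon as `[p]˜ ≠ 0`**, over any field of characteristic `p`
(the proof of `formalMul_map_toZMod_ne_zero_of_formalMul_prime_ne_zero`, which is stated over `𝔽_p`).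
[cite: SilvermanAEC2009, IV.7] -/
theorem formalMul_ne_zero_of_formalMul_prime_ne_zero (hP : E.formalMul p ≠ 0) {n : ℕ} (hn : 0 < n) :
    E.formalMul n ≠ 0 := by
  have hpow : ∀ j : ℕ, E.formalMul (p ^ j) ≠ 0 := by
    intro j
    induction j with
    | zero => rw [pow_zero]; intro h; have := congrArg (coeff 1) h
              rw [coeff_one_formalMul', Nat.cast_one, map_zero] at this; exact one_ne_zero this
    | succ j ih =>
      rw [pow_succ', ← E.formalMul_mul_subst' p (p ^ j)]
      exact subst_ne_zero_of_ne_zero hP (E.constantCoeff_formalMul _) ih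
  obtain ⟨j, m, hm, rfl⟩ := Nat.exists_eq_pow_mul_and_not_dvd hn.ne' p hp.out.ne_one
  rw [← E.formalMul_mul_subst' (p ^ j) m]
  refine subst_ne_zero_of_ne_zero (hpow j) (E.constantCoeff_formalMul m) fun h ↦ ?_
  have := congrArg (coeff 1) h
  rw [coeff_one_formalMul', map_zero, CharP.cast_eq_zero_iff k p] at this
  exact hm this

end FieldHeight

section Minimal

/-- **A global minimal model is `ℤ_p`-minimal in Mathlib's `ℚ_[p]`** for every prime `p` (the tree's
`isMinimal_baseChange_padic_of_isGloballyMinimal` at the place over `p`).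
[cite: SilvermanAEC2009, VIII.8 Definition of a global minimal equation (PDF p. 211)] -/
theorem isMinimal_map_padic_of_isGloballyMinimal (W : WeierstrassCurve ℚ) [W.IsGloballyMinimal]
    (p : ℕ) [hp : Fact p.Prime] : (W.map (algebraMap ℚ ℚ_[p])).IsMinimal ℤ_[p] := by
  obtain ⟨v, hv⟩ : ∃ v : HeightOneSpectrum (𝓞 ℚ), ((primesEquiv v : Nat.Primes) : ℕ) = p :=
    ⟨primesEquiv.symm ⟨p, hp.out⟩, by rw [Equiv.apply_symm_apply]⟩
  subst hv
  exact isMinimal_baseChange_padic_of_isGloballyMinimal W v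

end Minimal

end WeierstrassCurve

/-! ### The theorem -/

namespace Literature.NumberTheory.EllipticCurves

open PowerSeries Literature.RingTheory.FormalGroups Literature.NumberTheory.EllipticCurves.ModularForms
open Literature.NumberTheory.EllipticCurves.HondaCongruence Literature.NumberTheory.Automorphic
open Literature.NumberTheory.GaloisRepresentations
open _root_.WeierstrassCurve
open scoped MatrixGroups ModularForm
open CongruenceSubgroup IsLocalRing

set_option maxHeartbeats 800000 in
/-- **The Manin-constant multiplier is a `p`-adic integer at every additive prime `p ≥ 5`.** For the
data of `edixhoven_int_of_neronLattice_eq_smul_periodLattice` (`W'/ℚ` globally minimal,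
`IsNewformOf W' f`, `Λ_{L'} = q Λ_f` exactly) and a prime `p ≥ 5` with `p ∣ Δ_min(W')` and
`p ∣ c₄(W')` (additive reduction, Silverman VII.5.1(c)): `‖q‖_p ≤ 1`. Proof: steps 1–5 of
`ManinConstantGoodPrimesProofs` verbatim, then steps 6–9 of the module docstring (infinite height ⇒
free Honda witness; semistable twist over `O = 𝒪_{ℚ_p(p^{1/12})}`; the local lemma over `O`).
[cite: EdixhovenManin1991, Prop. 2] [cite: PastenShimura2024, §10.1 (p. 33)]
[cite: Honda1970, Thm. 2 (p. 223)] -/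
theorem padicNorm_le_one_of_neronLattice_eq_smul_periodLattice_of_dvd_of_dvd {N : ℕ} [NeZero N]
    {W' : WeierstrassCurve ℚ} [W'.IsElliptic] [W'.IsGloballyMinimal] {f : CuspForm (Gamma0 N) 2}
    {L' : PeriodPair} (hf : IsNewformOf W' f) (hL' : IsNeronLatticeOf (W'.baseChange ℂ) L')
    {q : ℚ} (hq : ∀ z ∈ periodLattice f, (q : ℂ) * z ∈ L'.lattice)
    (hq' : ∀ z ∈ L'.lattice, ∃ w ∈ periodLattice f, z = q * w)
    {p : ℕ} [Fact p.Prime] (hp5 : 5 ≤ p) (hΔp : (p : ℤ) ∣ minimalDiscriminantInt W')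
    (hc₄p : (p : ℤ) ∣ (integralModelInt W').c₄) :
    ‖(q : ℚ_[p])‖ ≤ 1 := by
  /- Step 1: lattices. `q ≠ 0`, `L := q⁻¹ L'` spans `Λ_f`, the short model `E` of `ℂ/Λ_f`. -/
  have hq0 : q ≠ 0 := by
    rintro rfl
    obtain ⟨w, -, hw⟩ := hq' L'.ω₁ L'.ω₁_mem_lattice
    rw [Rat.cast_zero, zero_mul] at hw
    exact (LinearIndependent.ne_zero 0 L'.indep) (by simpa using hw)
  have hqC : (q : ℂ) ≠ 0 := by exact_mod_cast hq0
  set L : PeriodPair := L'.mulLeft ((q : ℂ)⁻¹) (inv_ne_zero hqC) with hLdef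
  have hL : ∀ x, x ∈ L.lattice ↔ x ∈ periodLattice f := fun x ↦ by
    rw [hLdef, PeriodPair.mem_mulLeft_lattice, inv_inv]
    constructor
    · intro hx
      obtain ⟨w, hw, hxw⟩ := hq' _ hx
      rwa [mul_left_cancel₀ hqC hxw]
    · exact hq x
  have hΛ : L'.lattice = (L.mulLeft (q : ℂ) hqC).lattice := by
    ext z
    rw [PeriodPair.mem_mulLeft_lattice, hL]
    constructor
    · intro hz
      obtain ⟨w, hw, rfl⟩ := hq' z hz
      rwa [← mul_assoc, inv_mul_cancel₀ hqC, one_mul]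
    · intro hz
      have h := hq _ hz
      rwa [← mul_assoc, mul_inv_cancel₀ hqC, one_mul] at h
  have hf0 : f ≠ 0 := hf.1.ne_zero
  have ha : ∀ n, ((W'.LFunction n : ℤ) : ℂ) = cuspCoeff f n := fun n ↦ (hf.2 n).symm
  have hrat : ∀ n, ∃ r : ℚ, (r : ℂ) = cuspCoeff f n := fun n ↦
    ⟨(W'.LFunction n : ℚ), by rw [← ha n, Rat.cast_intCast]⟩
  obtain ⟨⟨q₂, hq₂⟩, ⟨q₃, hq₃⟩⟩ :=
    PeriodPair.ratCast_g₂_g₃_of_lattice_eq_periodLattice f hf0 hrat L hL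
  set a₄ : ℚ := -q₂ / 4 with ha₄
  set a₆ : ℚ := -q₃ / 4 with ha₆
  have h₂ : L.g₂ = -4 * (a₄ : ℂ) := by rw [← hq₂, ha₄]; push_cast; ring
  have h₃ : L.g₃ = -4 * (a₆ : ℂ) := by rw [← hq₃, ha₆]; push_cast; ring
  set E : WeierstrassCurve ℚ := { a₁ := 0, a₂ := 0, a₃ := 0, a₄ := a₄, a₆ := a₆ } with hE
  haveI hEe : E.IsElliptic := isElliptic_shortModel h₂ h₃
  have hEL : IsNeronLatticeOf (E.baseChange ℂ) L := isNeronLatticeOf_shortModel h₂ h₃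
  /- Step 2: the modular parametrisation as a formal series `z ∈ Xℚ⟦X⟧ ∩ Frac ℤ⟦X⟧`. -/
  obtain ⟨z, P, Q, hz0, hQ, hPQ, hlog⟩ := exists_rat_series_formalLog_subst_eq f hf0
    (W'.LFunction : ℕ → ℤ) ha L (fun x hx ↦ (hL x).mpr hx) a₄ a₆ h₂ h₃
  /- Step 3: `C • E = W'` over `ℚ` with `0 < u(C)` and `‖u(C)‖_p = ‖q‖_p`. -/
  obtain ⟨e₄, e₆⟩ := hL'.c₄_eq_of_lattice_eq_mulLeft hqC hΛ
  have hc₄E : (E.baseChange ℂ).c₄ = (E.c₄ : ℂ) := by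
    simp [WeierstrassCurve.baseChange, WeierstrassCurve.map_c₄]
  have hc₆E : (E.baseChange ℂ).c₆ = (E.c₆ : ℂ) := by
    simp [WeierstrassCurve.baseChange, WeierstrassCurve.map_c₆]
  have h₄ : W'.c₄ = (q ^ 4)⁻¹ * E.c₄ := by
    have h : ((W'.c₄ : ℚ) : ℂ) = (((q ^ 4)⁻¹ * E.c₄ : ℚ) : ℂ) := by
      rw [e₄, hEL.1, hc₄E]; push_cast; ring
    exact_mod_cast h
  have h₆ : W'.c₆ = (q ^ 6)⁻¹ * E.c₆ := by
    have h : ((W'.c₆ : ℚ) : ℂ) = (((q ^ 6)⁻¹ * E.c₆ : ℚ) : ℂ) := by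
      rw [e₆, hEL.2, hc₆E]; push_cast; ring
    exact_mod_cast h
  obtain ⟨vc, hC, hCpos⟩ : ∃ vc : VariableChange ℚ, vc • E = W' ∧ 0 < (vc.u : ℚ) := by
    obtain ⟨vc, hC⟩ := exists_variableChange_of_c₄_eq_of_c₆_eq hq0 h₄ h₆
    rcases lt_or_gt_of_ne vc.u.ne_zero with hneg | hpos
    · have hE' : (⟨-1, 0, 0, 0⟩ : VariableChange ℚ) • E = E := by
        rw [hE, smul_shortModel, inv_neg_one]
        congr 1 <;> push_cast <;> ring
      refine ⟨vc * ⟨-1, 0, 0, 0⟩, by rw [mul_smul, hE', hC], ?_⟩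
      show 0 < ((vc.u * -1 : ℚˣ) : ℚ)
      rw [Units.val_mul, Units.val_neg, Units.val_one]
      linarith
    · exact ⟨vc, hC, hpos⟩
  have hCu0 : (vc.u : ℚ) ≠ 0 := vc.u.ne_zero
  -- `‖u(vc)‖_p = ‖q‖_p`
  have hnorm : ‖((vc.u : ℚ) : ℚ_[p])‖ = ‖(q : ℚ_[p])‖ := by
    have hW4 : W'.c₄ = ((vc.u : ℚ))⁻¹ ^ 4 * E.c₄ := by
      rw [← hC, variableChange_c₄, Units.val_inv_eq_inv_val]
    have hW6 : W'.c₆ = ((vc.u : ℚ))⁻¹ ^ 6 * E.c₆ := by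
      rw [← hC, variableChange_c₆, Units.val_inv_eq_inv_val]
    have hΔ : E.c₄ ≠ 0 ∨ E.c₆ ≠ 0 := by
      by_contra hcon
      rw [not_or, not_not, not_not] at hcon
      have h1728 := E.c_relation
      rw [hcon.1, hcon.2] at h1728
      exact E.isUnit_Δ.ne_zero (by linear_combination (1 / 1728 : ℚ) * h1728)
    have key : (vc.u : ℚ) ^ 4 = q ^ 4 ∨ (vc.u : ℚ) ^ 6 = q ^ 6 := by
      rcases hΔ with hc | hc
      · left
        have h' := mul_right_cancel₀ hc (hW4.symm.trans h₄)
        rw [inv_pow] at h'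
        exact inv_injective h'
      · right
        have h' := mul_right_cancel₀ hc (hW6.symm.trans h₆)
        rw [inv_pow] at h'
        exact inv_injective h'
    rcases key with h | h
    · have h' : ‖((vc.u : ℚ) : ℚ_[p])‖ ^ 4 = ‖(q : ℚ_[p])‖ ^ 4 := by
        rw [← norm_pow, ← norm_pow, ← Rat.cast_pow, ← Rat.cast_pow, h]
      exact (pow_left_inj₀ (norm_nonneg _) (norm_nonneg _) (by norm_num)).mp h'
    · have h' : ‖((vc.u : ℚ) : ℚ_[p])‖ ^ 6 = ‖(q : ℚ_[p])‖ ^ 6 := by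
        rw [← norm_pow, ← norm_pow, ← Rat.cast_pow, ← Rat.cast_pow, h]
      exact (pow_left_inj₀ (norm_nonneg _) (norm_nonneg _) (by norm_num)).mp h'
  rw [← hnorm]
  /- Step 4: base change to `ℚ_p`; the scaled short model `E₀ = S • E` and `C₀ = C S⁻¹`. -/
  set φ : ℚ →+* ℚ_[p] := algebraMap ℚ ℚ_[p] with hφ
  set Wp : WeierstrassCurve ℚ_[p] := W'.map φ with hWp
  set Ep : WeierstrassCurve ℚ_[p] := E.map φ with hEp
  set Cp : VariableChange ℚ_[p] := vc.map (φ : ℚ →+* ℚ_[p]) with hCp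
  have hCE : Cp • Ep = Wp := by rw [hCp, hEp, hWp, map_variableChange, hC]
  have hCpu : (Cp.u : ℚ_[p]) = ((vc.u : ℚ) : ℚ_[p]) := by simp [hCp, VariableChange.map, hφ]
  rw [← hCpu]
  have hEp' : Ep = { a₁ := 0, a₂ := 0, a₃ := 0, a₄ := (a₄ : ℚ_[p]), a₆ := (a₆ : ℚ_[p]) } := by
    simp [hEp, hE, WeierstrassCurve.map, hφ]
  set S : VariableChange ℚ_[p] := ⟨Cp.u, 0, 0, 0⟩ with hS
  set E₀ : WeierstrassCurve ℚ_[p] := S • Ep with hE₀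
  set C₀ : VariableChange ℚ_[p] := Cp * S⁻¹ with hC₀
  have hC₀E₀ : C₀ • E₀ = Wp := by rw [hC₀, hE₀, mul_smul, inv_smul_smul, hCE]
  have hC₀u : C₀.u = 1 := by simp [hC₀, hS, VariableChange.mul_def, VariableChange.inv_def]
  haveI hE₀s : E₀.IsShortNF := by
    rw [hE₀, hS, hEp', smul_shortModel]
    exact ⟨rfl, rfl, rfl⟩
  -- `C₀ = toShortNF⁻¹`, so `E₀ = toShortNF • Wp` is `p`-integral and `θ₀` is `p`-integral
  set V : WeierstrassCurve ℤ_[p] := (integralModelInt W').map (Int.castRingHom ℤ_[p]) with hV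
  have hVc : V.map PadicInt.Coe.ringHom = Wp := map_coe_integralModelInt W'
  haveI hWpI : Wp.IsIntegral ℤ_[p] := by rw [← hVc]; exact V.isIntegral_map_coe
  have hTC₀ : Wp.toShortNF * C₀ = 1 :=
    VariableChange.eq_one_of_isShortNF_smul (E := E₀) (E' := Wp.toShortNF • Wp)
      (by rw [VariableChange.mul_def]; simp [toShortNF_u, hC₀u]) (by rw [mul_smul, hC₀E₀])
  have hC₀T : C₀ = Wp.toShortNF⁻¹ := eq_inv_of_mul_eq_one_right hTC₀
  have hE₀T : E₀ = Wp.toShortNF • Wp := by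
    rw [← inv_smul_eq_iff.mpr hC₀E₀.symm, hC₀T, inv_inv]
  haveI hE₀I : E₀.IsIntegral ℤ_[p] := by rw [hE₀T]; exact Wp.isIntegral_toShortNF_smul hp5
  /- Step 5: the series over `ℚ_p` and their logarithms. -/
  set ℓ : ℚ_[p]⟦X⟧ := PowerSeries.mk fun k ↦ ((W'.LFunction k : ℤ) : ℚ_[p]) / k with hℓ
  set zp : ℚ_[p]⟦X⟧ := z.map φ with hzp
  have hzs : HasSubst z := HasSubst.of_constantCoeff_zero' hz0
  have hzp0 : constantCoeff zp = 0 := by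
    rw [hzp, ← coeff_zero_eq_constantCoeff, coeff_map, coeff_zero_eq_constantCoeff, hz0, map_zero]
  have hzps : HasSubst zp := HasSubst.of_constantCoeff_zero' hzp0
  have hzp1 : coeff 1 zp = 1 := by
    have h1 := congrArg (coeff 1) hlog
    rw [coeff_one_subst_eq_mul _ hz0, coeff_one_formalLog, one_mul, coeff_mk, Nat.cast_one,
      div_one, W'.isMultiplicative_LFunction.map_one, Int.cast_one] at h1
    rw [hzp, coeff_map, h1, map_one]
  have hlogp : Ep.formalLog.subst zp = ℓ := by
    rw [hzp, hEp, ← E.map_formalLog φ, ← powerSeries_map_subst hzs φ, hlog]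
    ext n
    rw [coeff_map, coeff_mk, coeff_mk, map_div₀, map_natCast, map_intCast]
  set z₀ : ℚ_[p]⟦X⟧ := C (Cp.u : ℚ_[p]) * zp with hz₀
  have hz₀0 : constantCoeff z₀ = 0 := by rw [hz₀, map_mul, hzp0, mul_zero]
  have hz₀s : HasSubst z₀ := HasSubst.of_constantCoeff_zero' hz₀0
  have hz₀1 : coeff 1 z₀ = (Cp.u : ℚ_[p]) := by rw [hz₀, coeff_C_mul, hzp1, mul_one]
  -- `log_{E₀}(u z) = u ℓ` and `log_{W'}(θ₀(u z)) = u ℓ`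
  have hlog₀ : E₀.formalLog.subst z₀ = C (Cp.u : ℚ_[p]) * ℓ := by
    rw [hE₀, hz₀, hS, Ep.formalLog_uScale_smul_subst Cp.u hzp0, hlogp]
  /- Step 6 (infinite height): an integral model `V₀` of `E₀`; `E₀ mod p` is `y² = x³`, so
  `log_{E₀}, exp_{E₀} ∈ ℤ_p⟦X⟧`, and `ℓ ∈ ℤ_p⟦X⟧`: the Honda witness `ψ` is free. -/
  obtain ⟨V₀, hV₀⟩ := hE₀I.integral
  have hV₀c : V₀.map PadicInt.Coe.ringHom = E₀ := hV₀.symm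
  haveI hV₀s : (V₀.map PadicInt.Coe.ringHom).IsShortNF := by rw [hV₀c]; infer_instance
  have hWc₄ : Wp.c₄ = (((integralModelInt W').c₄ : ℤ) : ℚ_[p]) := by
    have hc : W'.c₄ = ((integralModelInt W').c₄ : ℚ) := by
      conv_lhs => rw [← map_integralModelInt W']
      rw [map_c₄, eq_intCast]
    rw [hWp, map_c₄, hc, hφ, eq_ratCast, Rat.cast_intCast]
  have hWΔ : Wp.Δ = ((minimalDiscriminantInt W' : ℤ) : ℚ_[p]) := by
    rw [hWp, map_Δ, ← cast_minimalDiscriminantInt, hφ, eq_ratCast, Rat.cast_intCast]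
  have hWpΔ0 : Wp.Δ ≠ 0 := by
    rw [hWΔ, Int.cast_ne_zero]; exact minimalDiscriminantInt_ne_zero W'
  have hE₀c₄ : E₀.c₄ = Wp.c₄ := by
    rw [hE₀T, variableChange_c₄, toShortNF_u, inv_one, Units.val_one, one_pow, one_mul]
  have hE₀Δ : E₀.Δ = Wp.Δ := by
    rw [hE₀T, variableChange_Δ, toShortNF_u, inv_one, Units.val_one, one_pow, one_mul]
  have hnc₄ : ‖(V₀.map PadicInt.Coe.ringHom).c₄‖ < 1 := by
    rw [hV₀c, hE₀c₄, hWc₄]; exact Padic.norm_intCast_lt_one_iff.mpr hc₄p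
  have hnΔ : ‖(V₀.map PadicInt.Coe.ringHom).Δ‖ < 1 := by
    rw [hV₀c, hE₀Δ, hWΔ]; exact Padic.norm_intCast_lt_one_iff.mpr hΔp
  have h0 : (V₀.map PadicInt.toZMod).formalMul p = 0 :=
    formalMul_prime_map_toZMod_eq_zero_of_isShortNF hp5 V₀ hnc₄ hnΔ
  have hℓ0 : constantCoeff ℓ = 0 := by
    rw [hℓ, ← coeff_zero_eq_constantCoeff_apply, coeff_mk, Nat.cast_zero, div_zero]
  have hℓint : ∀ n, ‖coeff n ℓ‖ ≤ 1 := W'.norm_coeff_lSeriesLog_le_one_of_dvd_of_dvd p hΔp hc₄p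
  obtain ⟨ψ, hψ0, hψi, hψ⟩ :=
    V₀.exists_padicInt_formalLog_subst_eq_of_formalMul_prime_eq_zero h0 hℓ0 hℓint
  rw [hV₀c] at hψ
  have hψs : HasSubst ψ := HasSubst.of_constantCoeff_zero' hψ0
  have hψI : IsPadicInt ψ := isPadicInt_iff_coeff.mpr hψi
  /- Step 7: `u = n₁ / d` in lowest terms; `[d]_{E₀}(z₀) = [n₁]_{E₀}(ψ) =: w ∈ ℤ_p⟦X⟧`. -/
  set d : ℕ := (vc.u : ℚ).den with hd
  have hd0 : 0 < d := (vc.u : ℚ).den_pos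
  have hnum : 0 < (vc.u : ℚ).num := Rat.num_pos.mpr hCpos
  set n₁ : ℕ := (vc.u : ℚ).num.toNat with hn₁
  have hn₁z : ((n₁ : ℕ) : ℤ) = (vc.u : ℚ).num := Int.toNat_of_nonneg hnum.le
  have hdu : (d : ℚ_[p]) * (Cp.u : ℚ_[p]) = (n₁ : ℚ_[p]) := by
    have h : ((vc.u : ℚ)) * d = ((vc.u : ℚ).num : ℚ) := Rat.mul_den_eq_num _
    rw [← hn₁z] at h
    have h' := congrArg (fun r : ℚ ↦ (r : ℚ_[p])) h
    simp only [Rat.cast_mul, Rat.cast_natCast, Int.cast_natCast] at h'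
    rw [hCpu, mul_comm]
    exact h'
  set w : ℚ_[p]⟦X⟧ := (E₀.formalMul n₁).subst ψ with hw
  have hwI : IsPadicInt w := (E₀.isPadicInt_formalMul n₁).powerSeries_subst hψI hψs
  have hw0 : constantCoeff w = 0 :=
    (Literature.NumberTheory.EllipticCurves.constantCoeff_subst_of_constantCoeff_eq_zero hψ0).trans
      (E₀.constantCoeff_formalMul n₁)
  have hlogw : E₀.formalLog.subst w = n₁ • ℓ := by
    rw [hw, ← subst_comp_subst_apply (E₀.hasSubst_formalMul n₁) hψs, E₀.formalLog_subst_formalMul n₁,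
      ← coe_substAlgHom hψs, map_nsmul, coe_substAlgHom, hψ]
  have hdz0 : constantCoeff ((E₀.formalMul d).subst z₀) = 0 :=
    (Literature.NumberTheory.EllipticCurves.constantCoeff_subst_of_constantCoeff_eq_zero hz₀0).trans
      (E₀.constantCoeff_formalMul d)
  have hlogd : E₀.formalLog.subst ((E₀.formalMul d).subst z₀) = n₁ • ℓ := by
    rw [← subst_comp_subst_apply (E₀.hasSubst_formalMul d) hz₀s, E₀.formalLog_subst_formalMul d,
      ← coe_substAlgHom hz₀s, map_nsmul, coe_substAlgHom, hlog₀, nsmul_eq_mul, nsmul_eq_mul,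
      ← mul_assoc, ← map_natCast (C : ℚ_[p] →+* ℚ_[p]⟦X⟧) d, ← map_mul, hdu, map_natCast]
  have hGw : (E₀.formalMul d).subst z₀ = w := E₀.eq_of_formalLog_subst_eq hdz0 hw0 (hlogd.trans hlogw.symm)
  obtain ⟨w₁, hw₁⟩ := isPadicInt_iff_exists_powerSeries_map.mp hwI
  -- the `Frac ℤ_p⟦X⟧`-witness for `z₀ = u z`: `z₀ · (d Q) = n₁ P`
  set Q₁ : ℤ_[p]⟦X⟧ := C (d : ℤ_[p]) * Q.map (Int.castRingHom ℤ_[p]) with hQ₁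
  set P₁ : ℤ_[p]⟦X⟧ := C (n₁ : ℤ_[p]) * P.map (Int.castRingHom ℤ_[p]) with hP₁
  have hintQ : ∀ R : ℤ⟦X⟧, (R.map (Int.castRingHom ℤ_[p])).map (algebraMap ℤ_[p] ℚ_[p]) =
      (R.map (Int.castRingHom ℚ)).map φ := fun R ↦ by
    ext n
    simp [coeff_map]
  have hPQp : zp * (Q.map (Int.castRingHom ℚ)).map φ = (P.map (Int.castRingHom ℚ)).map φ := by
    rw [hzp, ← map_mul, hPQ]
  have hQ₁0 : Q₁ ≠ 0 := by
    rw [hQ₁]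
    refine mul_ne_zero ?_ ?_
    · intro h0'
      have h := congrArg constantCoeff h0'
      rw [constantCoeff_C, map_zero, Nat.cast_eq_zero] at h
      exact hd0.ne' h
    · intro h0'
      apply hQ
      apply PowerSeries.map_injective (Int.castRingHom ℤ_[p]) Int.cast_injective
      rw [h0', map_zero]
  have hPQ₁ : z₀ * Q₁.map (algebraMap ℤ_[p] ℚ_[p]) = P₁.map (algebraMap ℤ_[p] ℚ_[p]) := by
    have e₁ : Q₁.map (algebraMap ℤ_[p] ℚ_[p]) = C (d : ℚ_[p]) * (Q.map (Int.castRingHom ℚ)).map φ := by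
      rw [hQ₁, map_mul, map_C, map_natCast (algebraMap ℤ_[p] ℚ_[p]) d, hintQ]
    have e₂ : P₁.map (algebraMap ℤ_[p] ℚ_[p]) = C (n₁ : ℚ_[p]) * (P.map (Int.castRingHom ℚ)).map φ := by
      rw [hP₁, map_mul, map_C, map_natCast (algebraMap ℤ_[p] ℚ_[p]) n₁, hintQ]
    have e₃ : C (Cp.u : ℚ_[p]) * C (d : ℚ_[p]) = (C (n₁ : ℚ_[p]) : ℚ_[p]⟦X⟧) := by
      rw [← map_mul, mul_comm, hdu]
    rw [e₁, e₂, hz₀, mul_mul_mul_comm, e₃, hPQp]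
  /- Step 8: the semistable twist over `O = 𝒪_{ℚ_p(π)}`, `π¹² = p`. -/
  -- `E₀ = (0, 0, 0, A, B)` with `A = V₀.a₄`, `B = V₀.a₆ ∈ ℤ_p`, not both zero, `¬(p⁴ ∣ A ∧ p⁶ ∣ B)`
  have hV₁ : V₀.a₁ = 0 := by
    have h := (V₀.map PadicInt.Coe.ringHom).a₁_of_isShortNF
    rw [map_a₁] at h
    exact PadicInt.coe_eq_zero.mp h
  have hV₂ : V₀.a₂ = 0 := by
    have h := (V₀.map PadicInt.Coe.ringHom).a₂_of_isShortNF
    rw [map_a₂] at h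
    exact PadicInt.coe_eq_zero.mp h
  have hV₃ : V₀.a₃ = 0 := by
    have h := (V₀.map PadicInt.Coe.ringHom).a₃_of_isShortNF
    rw [map_a₃] at h
    exact PadicInt.coe_eq_zero.mp h
  have hE₀V : E₀ = { a₁ := 0, a₂ := 0, a₃ := 0, a₄ := (V₀.a₄ : ℚ_[p]), a₆ := (V₀.a₆ : ℚ_[p]) } := by
    rw [← hV₀c]
    ext <;> simp [WeierstrassCurve.map, hV₁, hV₂, hV₃]
  have hAB : V₀.a₄ ≠ 0 ∨ V₀.a₆ ≠ 0 := by
    by_contra hcon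
    rw [not_or, not_not, not_not] at hcon
    apply hWpΔ0
    rw [← hE₀Δ, E₀.Δ_of_isShortNF, hE₀V]
    simp [hcon.1, hcon.2]
  haveI hWpmin : Wp.IsMinimal ℤ_[p] := by
    rw [hWp, hφ]; exact isMinimal_map_padic_of_isGloballyMinimal W' p
  have hmin : ¬ ((p : ℤ_[p]) ^ 4 ∣ V₀.a₄ ∧ (p : ℤ_[p]) ^ 6 ∣ V₀.a₆) :=
    not_pow_dvd_of_isMinimal Wp hWpΔ0 Wp.toShortNF (toShortNF_u Wp) (hE₀T.symm.trans hE₀V)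
  obtain ⟨k, i, j, A₁, B₁, hk12, hik, hjk, hA, hB, hFH⟩ :=
    exists_semistableTwistData hp5 V₀.a₄ V₀.a₆ hAB hmin
  -- the ring `O = 𝒪_E`, `E = ℚ_p(π)`, `π¹² = p`
  obtain ⟨π, hπ⟩ := IsAlgClosed.exists_pow_nat_eq ((p : ℕ) : PadicAlgCl p) (by norm_num : 0 < 12)
  set E : IntermediateField ℚ_[p] (PadicAlgCl p) := ℚ_[p]⟮π⟯ with hEdef
  haveI hEfd : FiniteDimensional ℚ_[p] E :=
    IntermediateField.adjoin.finiteDimensional (Algebra.IsAlgebraic.isAlgebraic π).isIntegral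
  set O := padicCoeffRing E with hOdef
  letI hOloc : IsLocalRing O := isLocalRing_padicCoeffRing E
  haveI hOpid : IsPrincipalIdealRing O := isPrincipalIdealRing_padicCoeffRing E
  haveI hOcpl : IsAdicComplete (maximalIdeal O) O := isAdicComplete_padicCoeffRing E
  letI hOch : CharP (ResidueField O) p := charP_residueField_padicCoeffRing E
  have hp1R : (1 : ℝ) < p := by exact_mod_cast (Fact.out : p.Prime).one_lt
  have hπnorm : ‖π‖ ^ 12 = (p : ℝ)⁻¹ := by rw [← norm_pow, hπ, norm_natCast_padicAlgCl]
  have hπle : ‖π‖ ≤ 1 := by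
    by_contra hcon
    rw [not_le] at hcon
    have h1 : (1 : ℝ) < ‖π‖ ^ 12 := one_lt_pow₀ hcon (by norm_num)
    rw [hπnorm] at h1
    exact absurd h1 (not_lt.mpr (inv_le_one_of_one_le₀ hp1R.le))
  have hπlt : ‖π‖ < 1 := by
    by_contra hcon
    rw [not_lt] at hcon
    have h1 : (1 : ℝ) ≤ ‖π‖ ^ 12 := one_le_pow₀ hcon
    rw [hπnorm] at h1
    exact absurd h1 (not_le.mpr (inv_lt_one_of_one_lt₀ hp1R))
  have hπ0 : π ≠ 0 := by
    intro h
    rw [h, zero_pow (by norm_num)] at hπ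
    exact (Fact.out : p.Prime).ne_zero (by exact_mod_cast hπ.symm)
  set πE : E := ⟨π, IntermediateField.mem_adjoin_simple_self ℚ_[p] π⟩ with hπEdef
  have hπEc : ((πE : E) : PadicAlgCl p) = π := rfl
  have hπE0 : (πE : E) ≠ 0 := fun h ↦ hπ0 (by rw [← hπEc, h]; rfl)
  set πO : O := ⟨πE, (mem_padicCoeffRing_iff E πE).mpr (by rw [hπEc]; exact hπle)⟩ with hπOdef
  have hπOc : ((πO : O) : E) = πE := rfl
  have hπOmax : πO ∈ maximalIdeal O := by
    rw [mem_maximalIdeal_padicCoeffRing_iff, hπOc, hπEc]; exact hπlt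
  set ι : ℤ_[p] →+* O := padicIntToCoeffRing E with hιdef
  set φE : ℚ_[p] →+* E := algebraMap ℚ_[p] E with hφE
  have halgO : ∀ y : O, algebraMap O E y = (y : E) := fun y ↦ rfl
  have hinjO : Function.Injective (algebraMap O E) := fun x y h ↦ Subtype.ext h
  have hιφ : ∀ x : ℤ_[p], algebraMap O E (ι x) = φE (x : ℚ_[p]) := fun x ↦ rfl
  have hιφ' : (algebraMap O E).comp ι = φE.comp (algebraMap ℤ_[p] ℚ_[p]) := RingHom.ext hιφ
  have hπE12 : (πE : E) ^ 12 = ((p : ℕ) : E) := by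
    apply (algebraMap E (PadicAlgCl p)).injective
    rw [map_pow, map_natCast]
    exact hπ
  have hpE : ((p : ℕ) : E) = φE ((p : ℕ) : ℚ_[p]) := (map_natCast φE p).symm
  -- the `O`-curve `V''` and its reduction
  set A'' : O := πO ^ (12 * i - 4 * k) * ι A₁ with hA''
  set B'' : O := πO ^ (12 * j - 6 * k) * ι B₁ with hB''
  set V'' : WeierstrassCurve O := { a₁ := 0, a₂ := 0, a₃ := 0, a₄ := A'', a₆ := B'' } with hV''
  set V₁ : WeierstrassCurve ℤ_[p] :=
    { a₁ := 0, a₂ := 0, a₃ := 0, a₄ := if 12 * i = 4 * k then A₁ else 0,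
      a₆ := if 12 * j = 6 * k then B₁ else 0 } with hV₁
  set jj : ZMod p →+* ResidueField O := ZMod.castHom (dvd_refl p) (ResidueField O) with hjj
  have hres : ∀ (m : ℕ) (x : ℤ_[p]), residue O (πO ^ m * ι x) =
      jj (PadicInt.toZMod (if m = 0 then x else 0)) := by
    intro m x
    rcases Nat.eq_zero_or_pos m with rfl | hm
    · rw [pow_zero, one_mul, if_pos rfl, hιdef, residue_padicIntToCoeffRing]
    · rw [if_neg hm.ne', map_zero, map_zero, map_mul, map_pow, (residue_eq_zero_iff _).mpr hπOmax,
        zero_pow hm.ne', zero_mul]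
  have hV''r : V''.map (residue O) = (V₁.map PadicInt.toZMod).map jj := by
    rw [hV'', hV₁]
    ext
    · show residue O 0 = jj (PadicInt.toZMod 0)
      rw [map_zero, map_zero, map_zero]
    · show residue O 0 = jj (PadicInt.toZMod 0)
      rw [map_zero, map_zero, map_zero]
    · show residue O 0 = jj (PadicInt.toZMod 0)
      rw [map_zero, map_zero, map_zero]
    · show residue O (πO ^ (12 * i - 4 * k) * ι A₁) =
        jj (PadicInt.toZMod (if 12 * i = 4 * k then A₁ else 0))
      rw [hres]
      congr 2
      by_cases h : 12 * i = 4 * k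
      · rw [if_pos (show 12 * i - 4 * k = 0 by omega), if_pos h]
      · rw [if_neg (show ¬ 12 * i - 4 * k = 0 by omega), if_neg h]
    · show residue O (πO ^ (12 * j - 6 * k) * ι B₁) =
        jj (PadicInt.toZMod (if 12 * j = 6 * k then B₁ else 0))
      rw [hres]
      congr 2
      by_cases h : 12 * j = 6 * k
      · rw [if_pos (show 12 * j - 6 * k = 0 by omega), if_pos h]
      · rw [if_neg (show ¬ 12 * j - 6 * k = 0 by omega), if_neg h]
  -- finite height of `V'' mod π`: some coefficient of `[d]_{V''}` in positive degree is a unit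
  obtain ⟨nn, hnn, hunit⟩ : ∃ nn : ℕ, 0 < nn ∧ IsUnit (coeff nn (V''.formalMul d)) := by
    have hP : (V''.map (residue O)).formalMul p ≠ 0 := by
      rw [hV''r, ← map_formalMul]
      intro h0'
      apply hFH
      apply PowerSeries.map_injective (jj : ZMod p →+* ResidueField O) jj.injective
      rw [h0', map_zero]
    have hD : (V''.map (residue O)).formalMul d ≠ 0 :=
      (V''.map (residue O)).formalMul_ne_zero_of_formalMul_prime_ne_zero hP hd0
    obtain ⟨nn, hnn⟩ := exists_coeff_ne_zero_iff_ne_zero.mpr hD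
    rw [← map_formalMul, coeff_map] at hnn
    refine ⟨nn, Nat.pos_of_ne_zero ?_, ?_⟩
    · rintro rfl
      apply hnn
      rw [coeff_zero_eq_constantCoeff_apply, V''.constantCoeff_formalMul d, map_zero]
    · by_contra hu
      apply hnn
      exact (residue_eq_zero_iff _).mpr ((IsLocalRing.mem_maximalIdeal _).mpr hu)
  -- over `E`: `V'' = (πᵏ, 0, 0, 0) • E₀`
  set E₀E : WeierstrassCurve E := E₀.map φE with hE₀E
  set πEu : Eˣ := Units.mk0 ((πE : E) ^ k) (pow_ne_zero _ hπE0) with hπEu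
  have hV''E : V''.map (algebraMap O E) = (⟨πEu, 0, 0, 0⟩ : VariableChange E) • E₀E := by
    rw [hE₀E, hE₀V]
    have hmapE : ({ a₁ := 0, a₂ := 0, a₃ := 0, a₄ := (V₀.a₄ : ℚ_[p]), a₆ := (V₀.a₆ : ℚ_[p]) } :
        WeierstrassCurve ℚ_[p]).map φE =
        { a₁ := 0, a₂ := 0, a₃ := 0, a₄ := φE (V₀.a₄ : ℚ_[p]), a₆ := φE (V₀.a₆ : ℚ_[p]) } := by
      ext <;> simp [WeierstrassCurve.map]
    rw [hmapE, smul_shortModel, hV'']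
    have h4 : (A'' : E) = (πEu⁻¹ : Eˣ) ^ 4 * φE (V₀.a₄ : ℚ_[p]) := by
      rw [← halgO, hA'', map_mul, map_pow, halgO, hπOc, hιφ, hA]
      push_cast
      rw [map_mul, map_pow, ← hpE, ← hπE12, hπEu, Units.val_mk0, ← pow_mul,
        show 12 * i = (12 * i - 4 * k) + k * 4 by omega, pow_add, pow_mul, inv_pow,
        mul_comm ((πE : E) ^ (12 * i - 4 * k)) (((πE : E) ^ k) ^ 4), mul_assoc (((πE : E) ^ k) ^ 4),
        ← mul_assoc (((πE : E) ^ k) ^ 4)⁻¹, inv_mul_cancel₀ (pow_ne_zero 4 (pow_ne_zero k hπE0)),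
        one_mul, show 12 * i - 4 * k + k * 4 - 4 * k = 12 * i - 4 * k by omega]
    have h6 : (B'' : E) = (πEu⁻¹ : Eˣ) ^ 6 * φE (V₀.a₆ : ℚ_[p]) := by
      rw [← halgO, hB'', map_mul, map_pow, halgO, hπOc, hιφ, hB]
      push_cast
      rw [map_mul, map_pow, ← hpE, ← hπE12, hπEu, Units.val_mk0, ← pow_mul,
        show 12 * j = (12 * j - 6 * k) + k * 6 by omega, pow_add, pow_mul, inv_pow,
        mul_comm ((πE : E) ^ (12 * j - 6 * k)) (((πE : E) ^ k) ^ 6), mul_assoc (((πE : E) ^ k) ^ 6),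
        ← mul_assoc (((πE : E) ^ k) ^ 6)⁻¹, inv_mul_cancel₀ (pow_ne_zero 6 (pow_ne_zero k hπE0)),
        one_mul, show 12 * j - 6 * k + k * 6 - 6 * k = 12 * j - 6 * k by omega]
    refine WeierstrassCurve.ext ?_ ?_ ?_ ?_ ?_
    · show algebraMap O E 0 = 0
      rw [map_zero]
    · show algebraMap O E 0 = 0
      rw [map_zero]
    · show algebraMap O E 0 = 0
      rw [map_zero]
    · show algebraMap O E A'' = _
      rw [halgO, h4]
    · show algebraMap O E B'' = _
      rw [halgO, h6]
  -- `z'' = πᵏ z₀` and `[d]_{V''}(z'') = πᵏ w`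
  set z₀E : E⟦X⟧ := z₀.map φE with hz₀E
  have hz₀E0 : constantCoeff z₀E = 0 := by
    rw [hz₀E, ← coeff_zero_eq_constantCoeff, coeff_map, coeff_zero_eq_constantCoeff, hz₀0, map_zero]
  have hz₀Es : HasSubst z₀E := HasSubst.of_constantCoeff_zero' hz₀E0
  set z'' : E⟦X⟧ := C ((πE : E) ^ k) * z₀E with hz''
  have hz''0 : constantCoeff z'' = 0 := by rw [hz'', map_mul, hz₀E0, mul_zero]
  have hz''s : HasSubst z'' := HasSubst.of_constantCoeff_zero' hz''0
  have hz''1 : coeff 1 z'' = (πE : E) ^ k * φE (Cp.u : ℚ_[p]) := by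
    rw [hz'', coeff_C_mul, hz₀E, coeff_map, hz₀1]
  set w'' : O⟦X⟧ := C (πO ^ k) * w₁.map ι with hw''
  have hmm : ∀ R : ℤ_[p]⟦X⟧, (R.map ι).map (algebraMap O E) =
      (R.map (algebraMap ℤ_[p] ℚ_[p])).map φE := fun R ↦ by
    ext n
    simp only [coeff_map, hιφ]
    rfl
  have hwE : (w₁.map ι).map (algebraMap O E) = w.map φE := by
    rw [hmm, ← hw₁]
    rfl
  have hXs : HasSubst (C ((πE : E) ^ k) * X : E⟦X⟧) :=
    HasSubst.of_constantCoeff_zero' (by rw [map_mul, constantCoeff_X, mul_zero])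
  have hCπ : (C (πO ^ k) : O⟦X⟧).map (algebraMap O E) = C ((πE : E) ^ k) := by
    rw [map_C, map_pow, halgO, hπOc]
  have hGz : (V''.formalMul d).subst z'' = w''.map (algebraMap O E) := by
    rw [← subst_map_algebraMap (V''.formalMul d) hz''s, map_formalMul, hV''E, hz'',
      show C ((πE : E) ^ k) * z₀E = (C ((πE : E) ^ k) * X : E⟦X⟧).subst z₀E by
        rw [subst_mul hz₀Es, subst_C' hz₀Es, subst_X hz₀Es],
      ← subst_comp_subst_apply hXs hz₀Es,
      show (((⟨πEu, 0, 0, 0⟩ : VariableChange E) • E₀E).formalMul d).subst (C ((πE : E) ^ k) * X) =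
          C ((πE : E) ^ k) * E₀E.formalMul d from E₀E.formalMul_uScale_smul_subst πEu d,
      subst_mul hz₀Es, subst_C' hz₀Es, hE₀E, ← map_formalMul, hz₀E, ← powerSeries_map_subst hz₀s φE,
      hGw, hw'', map_mul, hCπ, hwE]
  -- the `Frac O⟦X⟧`-witness: `z'' · (d Q) = πᵏ n₁ P`
  set Q'' : O⟦X⟧ := Q₁.map ι with hQ''
  set P'' : O⟦X⟧ := C (πO ^ k) * P₁.map ι with hP''
  have hQ''0 : Q'' ≠ 0 := by
    rw [hQ'']
    intro h0'
    apply hQ₁0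
    apply PowerSeries.map_injective ι (padicIntToCoeffRing_injective E)
    rw [h0', map_zero]
  have hQ''E : Q''.map (algebraMap O E) = (Q₁.map (algebraMap ℤ_[p] ℚ_[p])).map φE := by
    rw [hQ'']; exact hmm Q₁
  have hP''E : P''.map (algebraMap O E) =
      C ((πE : E) ^ k) * (P₁.map (algebraMap ℤ_[p] ℚ_[p])).map φE := by
    rw [hP'', map_mul, hCπ, hmm]
  have hPQ'' : z'' * Q''.map (algebraMap O E) = P''.map (algebraMap O E) := by
    have h := congrArg (PowerSeries.map φE) hPQ₁
    rw [map_mul, ← hz₀E] at h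
    rw [hQ''E, hP''E, hz'', mul_assoc, h]
  /- Step 9: the local lemma over `O`, and `‖u‖ ≤ 1`. -/
  obtain ⟨z₃, hz₃⟩ := Literature.RingTheory.PowerSeries.exists_map_eq_of_subst_eq_map (O := O) (L := E)
    hinjO hnn hunit hz''0 hGz hQ''0 hPQ''
  have h1 : algebraMap O E (coeff 1 z₃) = (πE : E) ^ k * φE (Cp.u : ℚ_[p]) := by
    rw [← hz''1, ← hz₃, coeff_map]
  have hnormle : ‖π‖ ^ k * ‖(Cp.u : ℚ_[p])‖ ≤ 1 := by
    have h2 := norm_coe_padicCoeffRing_le E (coeff 1 z₃)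
    rw [← halgO, h1] at h2
    push_cast at h2
    rw [hπEc, norm_mul, norm_pow, IntermediateField.coe_algebraMap_apply] at h2
    change ‖π‖ ^ k * ‖((Cp.u : ℚ_[p]) : PadicAlgCl p)‖ ≤ 1 at h2
    rwa [PadicAlgCl.norm_extends] at h2
  exact Padic.norm_le_one_of_pow_mul_norm_le_one (norm_nonneg π) hπnorm hk12 hnormle

/-- **`‖q‖_p ≤ 1` at EVERY prime `p ≥ 5`** — good (`ManinConstantGoodPrimesProofs`), multiplicative
(`ManinConstantMultiplicativePrimesProofs`) or additive (above) reduction.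
[cite: EdixhovenManin1991, Prop. 2] [cite: PastenShimura2024, §10.1 (p. 33)] -/
theorem padicNorm_le_one_of_neronLattice_eq_smul_periodLattice_of_five_le {N : ℕ} [NeZero N]
    {W' : WeierstrassCurve ℚ} [W'.IsElliptic] [W'.IsGloballyMinimal] {f : CuspForm (Gamma0 N) 2}
    {L' : PeriodPair} (hf : IsNewformOf W' f) (hL' : IsNeronLatticeOf (W'.baseChange ℂ) L')
    {q : ℚ} (hq : ∀ z ∈ periodLattice f, (q : ℂ) * z ∈ L'.lattice)
    (hq' : ∀ z ∈ L'.lattice, ∃ w ∈ periodLattice f, z = q * w)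
    {p : ℕ} [Fact p.Prime] (hp5 : 5 ≤ p) : ‖(q : ℚ_[p])‖ ≤ 1 := by
  by_cases hadd : (p : ℤ) ∣ minimalDiscriminantInt W' ∧ (p : ℤ) ∣ (integralModelInt W').c₄
  · exact padicNorm_le_one_of_neronLattice_eq_smul_periodLattice_of_dvd_of_dvd hf hL' hq hq' hp5
      hadd.1 hadd.2
  · exact padicNorm_le_one_of_neronLattice_eq_smul_periodLattice_of_not_additive hf hL' hq hq' hp5 hadd

/-- **Corollary: every prime factor of `den q` divides `6`** (`q ∈ ℤ[1/6]`): for the strong Weil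
curve `|q| = c_f`, so the Manin constant is a `p`-adic unit at every `p ≥ 5` — Edixhoven's
integrality `c_f ∈ ℤ` (the named fact this file supports) away from `2` and `3`, by the elementary
finite-height route. [cite: EdixhovenManin1991, Prop. 2] [cite: PastenShimura2024, §10.1 (p. 33)] -/
theorem dvd_six_of_dvd_den_of_neronLattice_eq_smul_periodLattice {N : ℕ} [NeZero N]
    {W' : WeierstrassCurve ℚ} [W'.IsElliptic] [W'.IsGloballyMinimal] {f : CuspForm (Gamma0 N) 2}
    {L' : PeriodPair} (hf : IsNewformOf W' f) (hL' : IsNeronLatticeOf (W'.baseChange ℂ) L')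
    {q : ℚ} (hq : ∀ z ∈ periodLattice f, (q : ℂ) * z ∈ L'.lattice)
    (hq' : ∀ z ∈ L'.lattice, ∃ w ∈ periodLattice f, z = q * w)
    {p : ℕ} (hp : p.Prime) (hpq : p ∣ q.den) : p ∣ 6 := by
  rcases dvd_six_or_additive_of_dvd_den_of_neronLattice_eq_smul_periodLattice hf hL' hq hq' hp hpq with
    h6 | ⟨hΔ, hc₄⟩
  · exact h6
  haveI := Fact.mk hp
  by_contra hcon
  have hp2 : p ≠ 2 := by rintro rfl; exact hcon (by norm_num)
  have hp3 : p ≠ 3 := by rintro rfl; exact hcon (by norm_num)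
  have hp5 : 5 ≤ p := by
    have h2 := hp.two_le
    rcases Nat.lt_or_ge p 5 with h | h
    · interval_cases p
      · exact absurd rfl hp2
      · exact absurd rfl hp3
      · exact absurd hp (by decide)
    · exact h
  have hle := padicNorm_le_one_of_neronLattice_eq_smul_periodLattice_of_dvd_of_dvd hf hL' hq hq' hp5 hΔ hc₄
  -- `‖q‖_p ≤ 1` contradicts `p ∣ den q`
  have hlt : 1 < ‖(q : ℚ_[p])‖ := by
    have hqden : ‖((q.den : ℤ) : ℚ_[p])‖ < 1 :=
      Padic.norm_intCast_lt_one_iff.mpr (Int.natCast_dvd_natCast.mpr hpq)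
    have hnum : ‖((q.num : ℤ) : ℚ_[p])‖ = 1 := by
      refine le_antisymm (Padic.norm_int_le_one _) (not_lt.mp fun h ↦ ?_)
      have hpn : p ∣ q.num.natAbs := Int.natCast_dvd.mp (Padic.norm_intCast_lt_one_iff.mp h)
      have h1 : p ∣ 1 := by
        have h' := Nat.dvd_gcd hpn hpq
        rwa [Nat.Coprime.gcd_eq_one q.reduced] at h'
      exact hp.ne_one (Nat.dvd_one.mp h1)
    have hq'' : (q : ℚ_[p]) = ((q.num : ℤ) : ℚ_[p]) / ((q.den : ℤ) : ℚ_[p]) := by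
      rw [Int.cast_natCast, ← Rat.cast_intCast, ← Rat.cast_natCast, ← Rat.cast_div, Rat.num_div_den]
    have hden0 : 0 < ‖((q.den : ℤ) : ℚ_[p])‖ := by
      rw [norm_pos_iff, Int.cast_natCast, Nat.cast_ne_zero]
      exact q.den_nz
    rw [hq'', norm_div, hnum, one_div, one_lt_inv₀ hden0]
    exact hqden
  exact absurd hle (not_le.mpr hlt)

/-- **The same, stated primewise: every prime factor of `den q` is `2` or `3`.**
[cite: EdixhovenManin1991, Prop. 2] [cite: PastenShimura2024, §10.1 (p. 33)] -/
theorem eq_two_or_eq_three_of_dvd_den_of_neronLattice_eq_smul_periodLattice {N : ℕ} [NeZero N]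
    {W' : WeierstrassCurve ℚ} [W'.IsElliptic] [W'.IsGloballyMinimal] {f : CuspForm (Gamma0 N) 2}
    {L' : PeriodPair} (hf : IsNewformOf W' f) (hL' : IsNeronLatticeOf (W'.baseChange ℂ) L')
    {q : ℚ} (hq : ∀ z ∈ periodLattice f, (q : ℂ) * z ∈ L'.lattice)
    (hq' : ∀ z ∈ L'.lattice, ∃ w ∈ periodLattice f, z = q * w)
    {p : ℕ} (hp : p.Prime) (hpq : p ∣ q.den) : p = 2 ∨ p = 3 := by
  have h6 := dvd_six_of_dvd_den_of_neronLattice_eq_smul_periodLattice hf hL' hq hq' hp hpq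
  rcases (Nat.Prime.dvd_mul hp).mp (show p ∣ 2 * 3 from h6) with h | h
  · exact Or.inl ((Nat.prime_dvd_prime_iff_eq hp Nat.prime_two).mp h)
  · exact Or.inr ((Nat.prime_dvd_prime_iff_eq hp Nat.prime_three).mp h)

/-- **`6ᵐ q ∈ ℤ` for some `m`**: the denominator of the Manin-constant multiplier `q` is a
`{2, 3}`-number (for the strong Weil curve: `6ᵐ c_f⁻¹ … `, i.e. `c_f ∈ ℤ[1/6]`; of course
`c_f ∈ ℤ` by Edixhoven's Prop. 2, which this file supports). [cite: EdixhovenManin1991, Prop. 2]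
[cite: PastenShimura2024, §10.1 (p. 33)] -/
theorem exists_six_pow_mul_mem_int_of_neronLattice_eq_smul_periodLattice {N : ℕ} [NeZero N]
    {W' : WeierstrassCurve ℚ} [W'.IsElliptic] [W'.IsGloballyMinimal] {f : CuspForm (Gamma0 N) 2}
    {L' : PeriodPair} (hf : IsNewformOf W' f) (hL' : IsNeronLatticeOf (W'.baseChange ℂ) L')
    {q : ℚ} (hq : ∀ z ∈ periodLattice f, (q : ℂ) * z ∈ L'.lattice)
    (hq' : ∀ z ∈ L'.lattice, ∃ w ∈ periodLattice f, z = q * w) :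
    ∃ (m : ℕ) (k : ℤ), (k : ℚ) = 6 ^ m * q := by
  -- `den q ∣ 6^(den q)`: every prime factor of `den q` is `2` or `3`
  have hden : q.den ∣ 6 ^ q.den := by
    have key : ∀ n : ℕ, 0 < n → (∀ p : ℕ, p.Prime → p ∣ n → p ∣ 6) → n ∣ 6 ^ n := by
      intro n hn hpr
      induction n using Nat.strong_induction_on with
      | _ n ih =>
        rcases Nat.lt_or_ge n 2 with h1 | h2
        · interval_cases n
          all_goals norm_num
        · obtain ⟨p, hp, hpn⟩ := Nat.exists_prime_and_dvd (by omega : n ≠ 1)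
          obtain ⟨m, rfl⟩ := hpn
          have hm0 : 0 < m := Nat.pos_of_mul_pos_left hn
          have hmlt : m < p * m := lt_mul_left hm0 hp.one_lt
          have hm := ih m hmlt hm0 (fun r hr hrm ↦ hpr r hr (dvd_mul_of_dvd_right hrm _))
          have hp6 : p ∣ 6 := hpr p hp (dvd_mul_right _ _)
          calc p * m ∣ 6 * 6 ^ m := mul_dvd_mul hp6 hm
            _ = 6 ^ (m + 1) := by ring
            _ ∣ 6 ^ (p * m) := pow_dvd_pow 6 (by nlinarith [hp.two_le])
    exact key q.den q.den_pos fun p hp hpq ↦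
      dvd_six_of_dvd_den_of_neronLattice_eq_smul_periodLattice hf hL' hq hq' hp hpq
  obtain ⟨c, hc⟩ := hden
  refine ⟨q.den, q.num * c, ?_⟩
  have e : (6 : ℚ) ^ q.den = (q.den : ℚ) * c := by exact_mod_cast hc
  have h2 := Rat.mul_den_eq_num q
  rw [e, Int.cast_mul, Int.cast_natCast]
  linear_combination (-(c : ℚ)) * h2

end Literature.NumberTheory.EllipticCurves
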